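import Mathlib
import HarnessLib
import HarnessLib.Audit
import Summits.HodgeConjecture.Statement
import Summits.HodgeConjecture.HodgeConjecture.Theses.SevenfoldWeilCensus
import Summits.HodgeConjecture.HodgeConjecture.Theorems.WeilTypeLadderNonsplitSixfoldsSqrtMinus3
import Summits.HodgeConjecture.HodgeConjecture.Theorems.WeilTypeLadderNscComponentMinusTwo
import Summits.HodgeConjecture.HodgeConjecture.Theorems.Ring2HypothesesWeilDiscriminantHolds
import HarnessLib.Audit.Status.Attr

/-!
Route: UnitaryReflectionCovers

CLOSED (exhausted) 2026-08-28T02:31:39Z by planner-hodge-idea-2-g3-0 — reason: exhausted — note: exhausted (opener, instrument I-2 run within the generation): CENSUS — Tried: (a) reflection-cover pieces G(6,1,3) F613 [t8 d wbar2 z] and G(6,1,4) b=14 data: class [-2] computed (kit j296759/j296790/j297271, parity law ~255 samples) BUT period map NOT dominant: monomial rank bound rank dPhi_V <= 3g. The file is kept as the record of this route; refuted decls are indexed as negative knowledge (`ledger negatives`).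

# Route UnitaryReflectionCovers — Non-split √-3 Weil sixfolds are reached by Galois pieces of
μ₆≀S₃-covers of ℙ¹

LINE (D-0145 ideator seat hodge-idea-2 g3, technique card «recent-theorem open-question harvest
2023–2026»; bears_on rung H2 =
`SevenfoldWeilCensus.WeilSixfolds`, cell NSC(−2) = (ℚ(√−3), sixfolds, discriminant class [−2] ∈
ℚ*/Nm ℚ(√−3)*), the cell Markman's
secant theorem (arXiv:2502.03415, discriminant −1 only) does not reach). It suffices to show X = X1
∧ X2 ∧ X3: X1 `ReflectionPieceReach` —
every member of NSC(−2) is the special fibre of a smooth projective family of (3,3) ℚ(√−3)-Weil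
sixfolds carrying a flat Weil class whose
fibres over a non-empty open set of the (irreducible, smooth) base are isogenous, compatibly with
√−3, to GALOIS PIECES P = e·J(C) of curves
C with a finite automorphism group G, C/G ≅ ℙ¹, √−3 acting through ℤ[G] (intended witness: the
9-dimensional family F₆₁₃ of natural-representation
pieces of G(6,1,3) = μ₆≀S₃-covers of ℙ¹ branched at 12 points with reflection datum [t⁸ d w̄² z],
whose discriminant class the seat's
equivariant-homology instrument computes to be [−2] in 12/12 samples, kit j296759); X2
`GaloisPieceWeilClasses` — the Weil classes of every such
Galois piece (ℚ(√−3), dimension 6, quotient ℙ¹) are algebraic (Patel–Zhang's open question,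
arXiv:2506.13729 §1, restricted to this slice);
X3 `OtherSixfoldCells` — the residual: all other sixfold cells of the rung (declared residual,
imported, not attacked). No summit and no rung is
proved by this line; X2 is an open problem and X1 a new geometric claim.
Lean: `ReflectionPieceReach ∧ GaloisPieceWeilClasses ∧ OtherSixfoldCells`

## Assembly
Pure logic over the tree's fact-free door `Ring2.Hypotheses.weilSixfolds_iff_components`
(WeilSixfolds ↔ every cell): the cell d = 3, δ = [−2]
is proved from X1 and X2 by the Baire/algebraicity-locus lemma
`WeilTypeLadder.mem_algebraicClasses_of_isOpen_subset_algebraicityLocus`, the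
isogeny transfer `HeckePrymWeilLine.stub_isogenyTransfer` and the transport
`HeckePrymWeilLine.owf_isoTransport` (all landed, sorry-free);
every other cell is X3. The deciding theorem `closes` in glue.lean elaborates (lean check rc 0, 0
sorry) and routes through `Assembly`.

CLOSES_TARGET: closes rung H2 of HodgeConjecture: Summit.HodgeConjecture.HodgeConjecture.Theses.SevenfoldWeilCensus.WeilSixfolds (D-0061; not the summit Statement) — the deciding theorem of this route concludes that registered leaf instead of the Statement decl `HodgeConjecture` (class rung: servable and labelled, never counted as concluding the summit Statement).

Rationale: WHY THIS LINE. Mechanism: Baire/Deligne locus argument of the tree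
(`WeilTypeLadder.mem_algebraicClasses_of_isOpen_subset_algebraicityLocus`, the pattern of
`Theorems/WeilTypeLadderNonsplitSixfoldsSqrtMinus3`) fed by a NEW dominant family inside a NON-SPLIT
cell: Galois pieces of complex-reflection-group
covers of ℙ¹. Imported from: complex reflection groups / Chevalley–Weil (the (3,3) count p = −dim V
+ Σ local exponents), Deligne–Mostow-type
local formulas for the discriminant of the skew-Hermitian intersection form on H¹(ℙ¹∖B, 𝕍) (the
seat's census: for μ₆ and μ₆≀S₃ data the class is
[2]^(number of local monodromies with eigenvalue −1), jobs j296235/j296679/j296759), and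
group-algebra cycles (Schoen 1988 for cyclic étale covers;
Patel–Zhang 2025 ask exactly for the Galois-piece generalisation). Sources: Schoen1988HodgeWeil,
vanGeemen1994HodgeAV (Thm 4.15, §7), arXiv:2506.13729,
arXiv:2502.03415, arXiv:2108.02087 (Rem. 7.2: the only method in print for non-trivial discriminant
is product specialisation from a SPLIT family one
dimension up). What no listed route does:
SplitImpliesAll/EightfoldBlochSeeds/FirstOrderSemiregularSeeds/CYFormCasimir all reach non-split
sixfolds
through split EIGHTFOLDS or semiregular seeds; HeckePrymWeil (dormant) uses étale cyclic Pryms,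
which the lattice lemma (principal polarisation ⇒
split class) confines to split cells; this line puts a curve-theoretic dominant family directly
inside NSC(−2).

RANKED CRUXES. #2 ReflectionPieceReach (crux) — X1 — every (3,3) ℚ(√−3)-Weil sixfold with
discriminant class [−2] (the binders of `Ring2.Hypotheses.WeilClassesComponent 3 3 [−2]`) is the
special fibre s₁ of a smooth projective family 𝒳 → S (S irreducible, smooth, quasi-projective) with
a flat class W restricting to the given Weil class, and a non-empty open U ⊆ S over which every
fibre is a (3,3) ℚ(√−3)-Weil sixfold carrying W|ₜ as a Weil class and is isogenous (u, v with u≫v =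
m·𝟙, u flat, v intertwining √−3) to a Galois piece P ⊆ J(C): C a smooth projective curve, α : Fin k
→ Aut C closed under composition with Σᵢ (αᵢ)_* = 0 on J(C) (i.e. C/G ≅ ℙ¹), P cut out by a
ℤ[G]-element (ιP, πP), √−3 = ψ₀ induced by Σ θᵢ(αᵢ)_*. Intended witness: F₆₁₃ (G(6,1,3), 12 branch
points, datum [t⁸ d w̄² z]) — dominance of its period map plus density/limit argument in the
connected Shimura component. [difficulty: L] (why it might fail: F₆₁₃'s period map M₀,₁₂ →
SU(3,3)-ball quotient (both 9-dim) may be nowhere immersive (Higgs field of the VHS degenerate), or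
the cell's moduli may have components missed by every Galois-piece family; the class [−2] verdict is
numerical (12 samples).) [arXiv:2506.13729, vanGeemen1994HodgeAV, Deligne1982HodgeCycles,
kit:j296759]
#3 GaloisPieceWeilClasses (crux) — X2 — for every smooth projective curve C with automorphisms α :
Fin k → Aut C closed under composition and Σᵢ (αᵢ)_* = 0 on J(C), every abelian subvariety P ⊆ J(C)
of dimension 6 cut out by a ℤ[G]-element and every ψ₀ ∈ End P with ψ₀² = −3 induced by ℤ[G], the
(3,3) ℚ(√−3)-Weil classes of (P, ψ₀) are algebraic. (Patel–Zhang's question «are the Hodge classes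
on Galois pieces P ∼ B^m algebraic?» on the slice K = ℚ(√−3), dim P = 6, C/G = ℙ¹; Schoen's
cyclic-cover cycles are the model.) [difficulty: open-problem] (why it might fail: no algebraic
cycle with non-zero Weil component is known on any non-split Weil sixfold; Schoen's mechanism needs
an étale cyclic structure over a simply connected linear system, absent for ramified G-covers of ℙ¹;
the statement also covers CM/decomposable pieces.) [arXiv:2506.13729, Schoen1988HodgeWeil,
vanGeemen1994HodgeAV, arXiv:2502.03415]
#6 OtherSixfoldCells (crux) — X3 (RESIDUAL, imported complement, not attacked by this line): Weil
classes are algebraic on every sixfold cell (ℚ(√−d), δ) with d ≠ 3, and on every ℚ(√−3) cell δ ≠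
[−2]. Contains Markman's split cells (arXiv:2502.03415 Thm 1.5.1, preprint) and the other non-split
cells (the tree's `SplitImpliesAll.NonsplitSixfoldCells` modulo J1); kind crux only because every
binder of `closes` must be crux-kind. [difficulty: open-problem] (why it might fail: it contains
open cases of the Hodge conjecture (non-split sixfold cells for every d, e.g. (ℚ(i), [3])); nothing
in print reaches them except conditional product specialisation from split eightfolds.)
[arXiv:2502.03415, arXiv:2108.02087, vanGeemen1994HodgeAV]

TWO-LAYER PLAN. X1 ⇐ X1a (the pieces of F₆₁₃ are (3,3) ℚ(√−3)-Weil sixfolds of class [−2]: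
Chevalley–Weil count + the local discriminant formula) → X1b (the
period map of F₆₁₃ is dominant: rank of the Higgs field θ : T M₀,₁₂ → Hom(H^(1, 0)_χ, H^(0, 1)_χ) at
one point) → X1c (density-to-reach: every member
of the connected cell component is a fibre of a smooth family whose general fibre is isogenous to a
piece — Deligne's period construction J1 plus
Hecke density) → X1. X2 ⇐ X2a (a ℤ[G]-projected Abel–Jacobi cycle on P has non-zero Weil component
for ONE piece of F₆₁₃) → X2b (monodromy of the
rank-2 Weil local system over the Hurwitz space is irreducible over ℚ, so one non-zero algebraic
section spans) → X2 on F₆₁₃; the general X2 is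
Patel–Zhang's question and may be narrowed to F₆₁₃ by a resplit once X1 is settled.

KILL CRITERIA. Refuted outright (close refuted:ReflectionPieceReach) if the discriminant class of
the F₆₁₃ pieces is [−1] AND no other complex-reflection datum over
ℚ(√−3) with a ≥ 9-dimensional base has class [−2] (the seat's census lists all rank-3 data; rank-4
data G(6,1,4) are in kit j296790), or if a
(3,3) ℚ(√−3)-Weil sixfold of class [−2] is exhibited that lies in no such family (e.g. a rigidity
theorem for the cell's Shimura component).
Pivot (resplit X1 to the F₆₁₃-only statement) if dominance holds for F₆₁₃ but the ∀-over-the-cell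
form fails on a second component. X2 refuted by a
single Galois piece (any G, C/G = ℙ¹, dim 6, √−3 from ℤ[G]) with a non-algebraic Weil class — that
would refute the Hodge conjecture itself.
Mooted if `SplitImpliesAll.NonsplitSixfoldCells` (K1) or split-eightfold routes close H2 first.

NOT DECOMPOSED YET. The dominance computation (Higgs-field rank of the F₆₁₃ VHS), the passage from
«dense image» to «every member is a special fibre» (needs the
period construction J1 and an isogeny/Hecke-orbit argument inside the cell), and the cycle
candidates for X2 (ℤ[G]-projections of W_r(C) ⊂ J(C),
Schoen-type components over G-invariant linear systems on C) are layer-2 children; typing them now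
would exceed the two-layer rule.

CHEAPEST FALSIFIER. Compute the discriminant class of ONE F₆₁₃ piece: build a product-one generating
12-tuple in G(6,1,3) of type [t⁸ d w̄² z], the equivariant
cellular H¹ of the cover, the V-isotypic skew-Hermitian intersection form over ℚ(√−3), and the
parity of v₂(det). RUN by the seat (GAP, kit
j296759 part F2, 12 random tuples + braid moves): dimension 6, form skew-Hermitian, det ∈ ℚ_{>0},
v₂(det) odd in 12/12 ⇒ class [−2] (non-split).
Controls: Klein quartic datum G₂₄/ℚ(√−7) and all rank-3 data with an even number of order-2
reflections give the split class (j296235, ≈560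
samples), cyclic μ₆ data obey class = [2]^#(local monodromy −1) (j296679, j296759). Next cheapest:
the Higgs-field rank of F₆₁₃ at one point.

NUMBERS. Cell: K = ℚ(√−3), (p,q) = (3,3), ℚ*/Nm K* ∋ [−1] (split, Markman) and [−2] = [2]·[−1] (2
inert). Family F₆₁₃: |G| = 1296, V = ℂ³, b = 12 branch
points (8 transposition-type reflections, 1 diagonal −1, 2 diagonal ω̄, 1 diagonal ζ₆), genus of C =
1 + |G|(−2 + Σ(1−1/ord))/2 = 1 +
648·(−2 + 9/2 + 4/3 + 5/6) = 1 + 648·(14/3) = 3025; dim_K M_V = −2·3 + 12 = 6, p = −3 + Σc = 3; dim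
M₀,₁₂ = 9 = dim SU(3,3)/S(U(3)×U(3)).
Siblings with odd order-2 count found non-split as well (j296790, partial): (t,d,w,w̄,z,z̄) =
(4,5,0,2,1,0), (4,1,2,4,1,0), … .

DEFINITION REQUESTS. None: Galois pieces are typed inline over
`Literature.AlgebraicGeometry.Motives.Jacobian.pushforward` (no named `GaloisPiece` structure is
requested; a definition item may be filed later if X2 is narrowed to F₆₁₃).

Novelty: Searches (2026-08-28): lit search "Weil type abelian fourfolds arbitrary discriminant Hodge
conjecture" (8 local: 2504.13607 p3, 1805.11574, 2501.02315,
2603.20268, 2502.03415 p7, 2203.09778, 2108.02087 p14, math/0211224; remote 9); lit search --hybrid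
"abelian varieties of Weil type non-trivial
discriminant algebraic cycles" (8: 2607.18341, green1994 p219–234, deligne1982 …); lit read
arXiv:2506.13729 (Patel–Zhang, Galois pieces, open
question §1); lit read arXiv:2108.02087 §7.3/Rem 7.2; earlier this seat: lit frontier/bridges
HodgeConjecture, galaxy "Weil type|discriminant" (g0–g2
records), 2509.23403, 2603.20268, 2605.20453, 2606.08882.
Nearest prior art found: Schoen1988HodgeWeil + addendum (cyclic triple covers: split ℚ(√−3)
sixfolds, hence all ℚ(√−3) FOURFOLD discriminants by
product specialisation, [corpus:arxiv-2108.02087 p14]); arXiv:2506.13729 (Patel–Zhang: Galois pieces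
dominated by curves, Hodge classes «not known to
be algebraic»); arXiv:2502.03415 (Markman: split 2n-folds n ≤ 3, fourfolds arbitrary discriminant by
products, p7).
Delta: nobody has placed a dominant curve-dominated family inside a NON-SPLIT Weil sixfold cell; the
parity law «class = [2]^#(−1-monodromies)» for
μ₆ and μ₆≀S₃ covers and the family F₆₁₃ are this seat's computation, and the line turns
Patel–Zhang's question into the one missing input for NSC(−2).
Claimed grade: new-combination  [refs: 2506.13729, 2108.02087, 2502.03415, arxiv-2108.02087]

Barriers (technique_class: explicit-family, variational-hodge, group-cycles): - technique_class: explicit-family, variational-hodge, group-cycles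
- Literature.Barriers.HodgeConjecture (semiregularity / Bloch pro-representability class, files
SemiregularityWeakCriterion*): outside — no
  semiregularity or deformation of a cycle class is used; algebraicity is to come from cycles on the
general piece (X2) and spread by the Baire/locus lemma.
- Kuga–Satake / hyperkähler-motivic descent (retired KugaSatakeDescent line, Floccari–Fu Conj 5.6):
outside — no HK variety or KS construction occurs.
- ℚ̄-way-station wall (critic SAME-WALL rule, QbarWayStations STRIKE 2026-08-28): outside — X1/X2
are statements about complex families and cycles,
  not about descending HC to ℚ̄ or to CM points; HC_CM is not invoked.
- Lattice lemma [this seat, NOTES B-g3-2 withdrawn]: principally polarisable sources (Jacobians,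
Prym–Tyurin, étale cyclic Pryms) have split class;
  evaded because F₆₁₃ pieces carry the induced NON-principal polarisation of class [−2] (computed).
- Negatives index: `ledger negatives --problem HodgeConjecture` read at g3 start (semiregularity
object-level witnesses, KugaSatake, RM-secant,
  QbarWayStations); no refuted statement concerns Galois pieces, reflection covers or the cell
NSC(−2) reach; X1–X3 restate none of them.

History (route lifecycle, newest last):
- 2026-08-28T02:31:41Z · CLOSED exhausted — exhausted (planner-hodge-idea-2-g3-0)

sub-problem: HodgeConjecture · status: closed(exhausted) · opened planner-hodge-idea-2-g3-0 2026-08-28T02:12:29Z · rev 0 · ledger route-HodgeConjecture-UnitaryReflectionCovers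
GENERATED by the gate from the ledger (D-0016/17). Provers cite these decls: `theorem foo : Summit.HodgeConjecture.HodgeConjecture.Theses.UnitaryReflectionCovers.<Decl> := …` in Summits/HodgeConjecture/HodgeConjecture/Theorems/<Name>.lean.
-/

namespace Summit.HodgeConjecture.HodgeConjecture.Theses.UnitaryReflectionCovers

open scoped BigOperators Topology Manifold Classical MeasureTheory ProbabilityTheory Matrix InnerProductSpace ComplexConjugate ContinuousMap
open Filter Set Function TopologicalSpace MeasureTheory

attribute [summit_statement] _root_.HodgeConjecture
attribute [summit_statement] _root_.Summit.HodgeConjecture.HodgeConjecture.Theses.SevenfoldWeilCensus.WeilSixfolds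

/-- item stmt-HodgeConjecture-24710 · crux · rank 2 · closed · moot by None · by planner
why it might fail: F₆₁₃'s period map M₀,₁₂ → SU(3,3)-ball quotient (both 9-dim) may be nowhere immersive (Higgs field of the VHS degenerate), or the cell's moduli may have components missed by every Galois-piece family; the class [−2] verdict is numerical (12 samples).
sources: arXiv:2506.13729, vanGeemen1994HodgeAV, Deligne1982HodgeCycles, kit:j296759
[crux] X1 — every (3,3) ℚ(√−3)-Weil sixfold with discriminant class [−2] (the binders of
`Ring2.Hypotheses.WeilClassesComponent 3 3 [−2]`) is the special fibre s₁ of a smooth projective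
family 𝒳 → S (S irreducible, smooth, quasi-projective) with a flat class W restricting to the given
Weil class, and a non-empty open U ⊆ S over which every fibre is a (3,3) ℚ(√−3)-Weil sixfold
carrying W|ₜ as a Weil class and is isogenous (u, v with u≫v = m·𝟙, u flat, v intertwining √−3) to a
Galois piece P ⊆ J(C): C a smooth projective curve, α : Fin k → Aut C closed under composition with
Σᵢ (αᵢ)_* = 0 on J(C) (i.e. C/G ≅ ℙ¹), P cut out by a ℤ[G]-element (ιP, πP), √−3 = ψ₀ induced by Σ
θᵢ(αᵢ)_*. Intended witness: F₆₁₃ (G(6,1,3), 12 branch points, datum [t⁸ d w̄² z]) — dominance of its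
period map plus density/limit argument in the connected Shimura component. [difficulty: L] -/
@[route_item "route-HodgeConjecture-UnitaryReflectionCovers", crux (experiment := "instrument: kit jobs cited as sources kit:j296759") (source := "ledger wanted_by.sources on stmt-HodgeConjecture-24710, 2026-09-01")]
def ReflectionPieceReach : Prop :=
  ∀ (A : Literature.AlgebraicGeometry.Motives.AbelianVariety ℂ) (φ : A ⟶ A), A.dim = 2 * 3 → Literature.AlgebraicGeometry.Motives.IsSmoothProjective (2 * 3) A.X → CategoryTheory.CategoryStruct.comp φ φ = -((3 : ℕ) • CategoryTheory.CategoryStruct.id A) → ∀ (e : Literature.AlgebraicGeometry.Motives.ProjectiveEmbedding A.X) (a : Literature.AlgebraicGeometry.HodgeTheory.complexBetti (Literature.AlgebraicGeometry.Motives.projectiveSpace e.n ℂ) 2), Literature.AlgebraicGeometry.HodgeTheory.IsRationalClass a → a ≠ 0 → Literature.AlgebraicGeometry.VanGeemen1994.HasWeilDiscriminantNondeg A φ 3 3 (((3 : ℕ) : ℂ) • Literature.AlgebraicGeometry.HodgeTheory.complexBetti.map e.ι 2 a + Literature.AlgebraicGeometry.HodgeTheory.complexBetti.map φ.hom.hom.hom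 2 (Literature.AlgebraicGeometry.HodgeTheory.complexBetti.map e.ι 2 a)) (QuotientGroup.mk (Units.mk0 (-2 : ℚ) (by norm_num))) → ∀ c : Literature.AlgebraicGeometry.HodgeTheory.complexBetti A.X (2 * 3), Literature.AlgebraicGeometry.HodgeTheory.IsRationalClass c → Literature.AlgebraicGeometry.HodgeTheory.IsOfHodgeType (2 * 3) A.X (2 * 3) 3 3 c → c ∈ Literature.AlgebraicGeometry.HodgeTheory.weilClassesOf A φ 3 3 → ∃ (𝒳 S : Literature.AlgebraicGeometry.Motives.SchemeOver ℂ) (f : 𝒳 ⟶ S) (s₁ : Literature.AlgebraicGeometry.Motives.ComplexPoints S) (ι : A.X ≅ Literature.AlgebraicGeometry.Motives.fiberOver f s₁) (W : Literature.AlgebraicGeometry.HodgeTheory.complexBetti 𝒳 (2 * 3)) (U : Set (Literature.AlgebraicGeometry.Motives.ComplexPoints S)), Literature.AlgebraicGeometry.Motives.IsSmoothProjectiveFamily f (2 * 3) ∧ Literature.AlgebraicGeometry.HodgeTheory.IsQuasiProjectiveOver 𝒳 ∧ Literature.AlgebraicGeometry.HodgeTheory.IsQuasiProjectiveOver S ∧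 IrreducibleSpace S.left ∧ AlgebraicGeometry.Smooth S.hom ∧ Literature.AlgebraicGeometry.HodgeTheory.complexBetti.map ι.hom (2 * 3) (Literature.AlgebraicGeometry.HodgeTheory.complexBetti.map (Literature.AlgebraicGeometry.Motives.fiberι f s₁) (2 * 3) W) = c ∧ IsOpen U ∧ U.Nonempty ∧ ∀ t ∈ U, ∃ (A'' : Literature.AlgebraicGeometry.Motives.AbelianVariety ℂ) (φ'' : A'' ⟶ A'') (e'' : A''.X ≅ Literature.AlgebraicGeometry.Motives.fiberOver f t), A''.dim = 2 * 3 ∧ CategoryTheory.CategoryStruct.comp φ'' φ'' = -((3 : ℕ) • CategoryTheory.CategoryStruct.id A'') ∧ Literature.AlgebraicGeometry.HodgeTheory.complexBetti.map e''.hom (2 * 3) (Literature.AlgebraicGeometry.HodgeTheory.complexBetti.map (Literature.AlgebraicGeometry.Motives.fiberι f t) (2 * 3) W) ∈ Literature.AlgebraicGeometry.HodgeTheory.weilClassesOf A'' φ'' 3 3 ∧ ∃ (C : Literature.AlgebraicGeometry.Motives.SchemeOver ℂ) (𝒥 : Literature.AlgebraicGeometry.Motives.Jacobian C) (k : ℕ)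 (α : Fin k → (C ⟶ C)) (θ ε : Fin k → ℤ) (P : Literature.AlgebraicGeometry.Motives.AbelianVariety ℂ) (ψ₀ : P ⟶ P) (ιP : P ⟶ 𝒥.J) (πP : 𝒥.J ⟶ P) (m' : ℕ) (u : A'' ⟶ P) (v : P ⟶ A'') (m : ℕ), Literature.AlgebraicGeometry.Motives.IsSmoothProjective 1 C ∧ (∀ i, CategoryTheory.IsIso (α i)) ∧ (∀ i j, ∃ l, CategoryTheory.CategoryStruct.comp (α i) (α j) = α l) ∧ (∑ i, 𝒥.pushforward 𝒥 (α i) = 0) ∧ P.dim = 2 * 3 ∧ CategoryTheory.CategoryStruct.comp ψ₀ ψ₀ = -((3 : ℕ) • CategoryTheory.CategoryStruct.id P) ∧ 0 < m' ∧ CategoryTheory.CategoryStruct.comp ιP πP = m' • CategoryTheory.CategoryStruct.id P ∧ CategoryTheory.CategoryStruct.comp πP ιP = ∑ i, ε i • 𝒥.pushforward 𝒥 (α i) ∧ CategoryTheory.CategoryStruct.comp ιP (∑ i, θ i • 𝒥.pushforward 𝒥 (α i)) = CategoryTheory.CategoryStruct.comp ψ₀ ιP ∧ 0 < m ∧ CategoryTheory.CategoryStruct.comp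 u v = m • CategoryTheory.CategoryStruct.id A'' ∧ AlgebraicGeometry.Flat u.hom.hom.hom.left ∧ CategoryTheory.CategoryStruct.comp v φ'' = CategoryTheory.CategoryStruct.comp ψ₀ v

/-- item stmt-HodgeConjecture-24711 · crux · rank 3 · closed · moot by None · by planner
why it might fail: no algebraic cycle with non-zero Weil component is known on any non-split Weil sixfold; Schoen's mechanism needs an étale cyclic structure over a simply connected linear system, absent for ramified G-covers of ℙ¹; the statement also covers CM/decomposable pieces.
sources: arXiv:2506.13729, Schoen1988HodgeWeil, vanGeemen1994HodgeAV, arXiv:2502.03415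
[crux] X2 — for every smooth projective curve C with automorphisms α : Fin k → Aut C closed under
composition and Σᵢ (αᵢ)_* = 0 on J(C), every abelian subvariety P ⊆ J(C) of dimension 6 cut out by a
ℤ[G]-element and every ψ₀ ∈ End P with ψ₀² = −3 induced by ℤ[G], the (3,3) ℚ(√−3)-Weil classes of
(P, ψ₀) are algebraic. (Patel–Zhang's question «are the Hodge classes on Galois pieces P ∼ B^m
algebraic?» on the slice K = ℚ(√−3), dim P = 6, C/G = ℙ¹; Schoen's cyclic-cover cycles are the
model.) [difficulty: open-problem] -/
@[route_item "route-HodgeConjecture-UnitaryReflectionCovers", crux]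
def GaloisPieceWeilClasses : Prop :=
  ∀ (C : Literature.AlgebraicGeometry.Motives.SchemeOver ℂ) (𝒥 : Literature.AlgebraicGeometry.Motives.Jacobian C) (k : ℕ) (α : Fin k → (C ⟶ C)) (θ ε : Fin k → ℤ) (P : Literature.AlgebraicGeometry.Motives.AbelianVariety ℂ) (ψ₀ : P ⟶ P) (ιP : P ⟶ 𝒥.J) (πP : 𝒥.J ⟶ P) (m' : ℕ), Literature.AlgebraicGeometry.Motives.IsSmoothProjective 1 C → (∀ i, CategoryTheory.IsIso (α i)) → (∀ i j, ∃ l, CategoryTheory.CategoryStruct.comp (α i) (α j) = α l) → (∑ i, 𝒥.pushforward 𝒥 (α i) = 0) → P.dim = 2 * 3 → CategoryTheory.CategoryStruct.comp ψ₀ ψ₀ = -((3 : ℕ) • CategoryTheory.CategoryStruct.id P) → 0 < m' → CategoryTheory.CategoryStruct.comp ιP πP = m' • CategoryTheory.CategoryStruct.id P → CategoryTheory.CategoryStruct.comp πP ιP = ∑ i, ε i • 𝒥.pushforward 𝒥 (α i) → CategoryTheory.CategoryStruct.comp ιP (∑ i, θ i • 𝒥.pushforward 𝒥 (α i)) = CategoryTheory.CategoryStruct.comp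 ψ₀ ιP → Literature.AlgebraicGeometry.HodgeTheory.weilClassesOf P ψ₀ 3 3 ≤ Literature.AlgebraicGeometry.HodgeTheory.algebraicClasses P.X 3

/-- item stmt-HodgeConjecture-24712 · crux · rank 6 · closed · moot by None · by planner
why it might fail: it contains open cases of the Hodge conjecture (non-split sixfold cells for every d, e.g. (ℚ(i), [3])); nothing in print reaches them except conditional product specialisation from split eightfolds.
sources: arXiv:2502.03415, arXiv:2108.02087, vanGeemen1994HodgeAV
[crux] X3 (RESIDUAL, imported complement, not attacked by this line): Weil classes are algebraic on
every sixfold cell (ℚ(√−d), δ) with d ≠ 3, and on every ℚ(√−3) cell δ ≠ [−2]. Contains Markman's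
split cells (arXiv:2502.03415 Thm 1.5.1, preprint) and the other non-split cells (the tree's
`SplitImpliesAll.NonsplitSixfoldCells` modulo J1); kind crux only because every binder of `closes`
must be crux-kind. [difficulty: open-problem] -/
@[route_item "route-HodgeConjecture-UnitaryReflectionCovers", crux]
def OtherSixfoldCells : Prop :=
  (∀ d : ℕ, 0 < d → d ≠ 3 → ∀ δ : Literature.AlgebraicGeometry.VanGeemen1994.weilNormResidueGroup d, Summit.HodgeConjecture.HodgeConjecture.Ring2.Hypotheses.WeilClassesComponent 3 d δ) ∧ (∀ δ : Literature.AlgebraicGeometry.VanGeemen1994.weilNormResidueGroup 3, δ ≠ QuotientGroup.mk (Units.mk0 (-2 : ℚ) (by norm_num)) → Summit.HodgeConjecture.HodgeConjecture.Ring2.Hypotheses.WeilClassesComponent 3 3 δ)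

/-- item stmt-HodgeConjecture-24713 · assembly · rank 1 · closed · moot by None · by planner
sources: vanGeemen1994HodgeAV, Deligne1982HodgeCycles
[assembly] ReflectionPieceReach → GaloisPieceWeilClasses → OtherSixfoldCells → WeilSixfolds (rung H2
leaf). -/
@[route_item "route-HodgeConjecture-UnitaryReflectionCovers"]
def Assembly : Prop :=
  ReflectionPieceReach → GaloisPieceWeilClasses → OtherSixfoldCells → Summit.HodgeConjecture.HodgeConjecture.Theses.SevenfoldWeilCensus.WeilSixfolds

/-! D-0027 §2.1 — DECIDING THEOREM (planner-authored via `route open/edit --closes-file`; by planner-hodge-idea-2-g3-0 2026-08-28T02:12:29Z) — ARCHIVED: route closed (exhausted) 2026-08-28T02:31:39Z; kept so importers keep building: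
its hypotheses are this route's items and its conclusion the registered leaf `Summit.HodgeConjecture.HodgeConjecture.Theses.SevenfoldWeilCensus.WeilSixfolds` (rung H2, D-0061) (glue_lint), and it elaborates with this file. -/

@[closes "route-HodgeConjecture-UnitaryReflectionCovers"] theorem closes (h1 : ReflectionPieceReach) (h2 : GaloisPieceWeilClasses) (h3 : OtherSixfoldCells) :
    Summit.HodgeConjecture.HodgeConjecture.Theses.SevenfoldWeilCensus.WeilSixfolds := by
  have hA : Assembly := by
    intro h1 h2 h3
    -- the route's own cell: NSC(-2) = (ℚ(√-3), sixfolds, discriminant class [-2]) from X1 (piece reach) and X2 (piece algebraicity)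
    have key : Summit.HodgeConjecture.HodgeConjecture.Ring2.Hypotheses.WeilClassesComponent 3 3
        (QuotientGroup.mk (Units.mk0 (-2 : ℚ) (by norm_num))) := by
      intro A φ hA hX hφ e a ha ha0 hdisc c hcQ hcH hcW
      obtain ⟨𝒳, S, f, s₁, ι, W, U, hf, h𝒳, hSqp, hirr, hsm, hιc, hU, hUne, hPiece⟩ :=
        h1 A φ hA hX hφ e a ha ha0 hdisc c hcQ hcH hcW
      rw [← hιc]
      haveI := hirr
      refine Summit.HodgeConjecture.HodgeConjecture.Theorems.isoInvariance_proof ι 3 _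
        (Summit.HodgeConjecture.HodgeConjecture.WeilTypeLadder.mem_algebraicClasses_of_isOpen_subset_algebraicityLocus
          f h𝒳 hSqp hsm hf W hU hUne ?_ s₁)
      intro t ht
      obtain ⟨A'', φ'', e'', hA''dim, hφ'', hWeil, C, 𝒥, k, α, θ, ε, P, ψ₀, ιP, πP, m', u, v, m, hC, hiso, hcl, hsum,
        hPdim, hψ, hm', hιπ, hπι, hθ, hm, huv, hu, hv⟩ := hPiece t ht
      have hPalg : Literature.AlgebraicGeometry.HodgeTheory.weilClassesOf P ψ₀ 3 3 ≤
          Literature.AlgebraicGeometry.HodgeTheory.algebraicClasses P.X 3 :=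
        h2 C 𝒥 k α θ ε P ψ₀ ιP πP m' hC hiso hcl hsum hPdim hψ hm' hιπ hπι hθ
      have hφ''ℤ : CategoryTheory.CategoryStruct.comp φ'' φ'' = -(((3 : ℕ) : ℤ) • CategoryTheory.CategoryStruct.id A'') := by
        rw [hφ'', natCast_zsmul]
      have hA''alg : Literature.AlgebraicGeometry.HodgeTheory.weilClassesOf A'' φ'' 3 3 ≤
          Literature.AlgebraicGeometry.HodgeTheory.algebraicClasses A''.X 3 :=
        Summit.HodgeConjecture.HodgeConjecture.Theorems.HeckePrymWeilLine.stub_isogenyTransfer 3 3 A'' _ φ'' ψ₀ hA''dim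
          hPdim hφ''ℤ u v m hm huv hu hv hPalg
      exact Summit.HodgeConjecture.HodgeConjecture.Theorems.HeckePrymWeilLine.owf_isoTransport _ A'' e'' 3 _ (hA''alg hWeil)
    refine Summit.HodgeConjecture.HodgeConjecture.Ring2.Hypotheses.weilSixfolds_iff_components.2 fun d hd δ => ?_
    by_cases hd3 : d = 3
    · subst hd3
      by_cases hδ : δ = QuotientGroup.mk (Units.mk0 (-2 : ℚ) (by norm_num))
      · subst hδ
        exact key
      · exact h3.2 δ hδ
    · exact h3.1 d hd hd3 δ
  exact hA h1 h2 h3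

end Summit.HodgeConjecture.HodgeConjecture.Theses.UnitaryReflectionCovers
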